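import Summits.PneNP.PneNP.Theses.PhaseTwins
import Literature.ModelTheory.FiniteModelTheory.CkEquivHomCount
import Literature.ModelTheory.FiniteModelTheory.CkEquivTransfer

/-!
# Negative-side toolkit for crux `PhaseTwins.PolyDepthTwinsAbove` (stmt-PneNP-2719): the gap factor is immaterial

`PolyDepthTwinsAbove` asks for twins with `Z_G(λ) ≥ 2·Z_H(λ)` at depth `n^θ`.  This file proves, sorry-free, the
DOUBLING step: from a witness family with factor `c ≥ 0` at exponent `θ` one gets a witness family with factor `c²`
at exponent `θ/2` (two disjoint copies: `Z` is multiplicative, `≡_{C^k}` is preserved by disjoint unions — the tree's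
PROVED `CkEquiv.sum`, transported through the PROVED Dvořák bridge — degrees are unchanged, and
`(2n)^{θ/2} ≤ n^θ` for `n ≥ 2`).  Iterating, every factor `c > 1` is as good as every other: a would-be disproof of the
crux at `(Δ, λ)` must therefore exclude `(1+ε)`-twins at depth `n^{o(1)}` for EVERY `ε > 0` (`noTwins_onePlusEps_of_noTwins`),
i.e. prove uniform `(1+ε)`-determinacy of `Z_G(λ)` by the `n^{o(1)}`-dimensional Weisfeiler–Leman type above `λ_c` —
the kernel-checked form of Disproof.lean §3(ii)/(vi) (cdisprove gen 3).  All statements are written against the crux's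
inlined body; no Theses declaration is concluded. [folklore]
-/

set_option linter.dupNamespace false

namespace Summit.PneNP.PneNP.Theorems.PolyDepthTwinsAbove.Negative

open scoped BigOperators Classical
open Literature.ModelTheory.FiniteModelTheory (CkEquiv Dvorak2010_ckEquiv_iff_homCount_holds)

/-- The crux's inlined hard-core sum `Σ_{I independent} λ^{|I|}` is nonnegative for `λ ≥ 0` (any finite vertex
type; all sums below are written out exactly as in the crux, no definition is introduced). -/
theorem Zs_nonneg {α : Type*} [Fintype α] (G : SimpleGraph α)
    {dG : ∀ I : Finset α, Decidable (G.IsIndepSet (↑I : Set α))} {lam : ℝ} (hlam : 0 ≤ lam) :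
    0 ≤ ∑ I : Finset α, @ite ℝ (G.IsIndepSet (↑I : Set α)) (dG I) (lam ^ I.card) 0 :=
  Finset.sum_nonneg fun I _ => by split_ifs <;> [exact pow_nonneg hlam _; exact le_rfl]

/-- Independence is transported along a graph isomorphism (general vertex types). -/
theorem isIndepSet_map_iff' {α β : Type*} {G : SimpleGraph α} {H : SimpleGraph β} (e : G ≃g H) (I : Finset α) :
    H.IsIndepSet (↑(I.map e.toEquiv.toEmbedding) : Set β) ↔ G.IsIndepSet (↑I : Set α) := by
  constructor
  · intro h a ha b hb hab hadj
    have ha' : e a ∈ I.map e.toEquiv.toEmbedding := Finset.mem_map.2 ⟨a, ha, rfl⟩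
    have hb' : e b ∈ I.map e.toEquiv.toEmbedding := Finset.mem_map.2 ⟨b, hb, rfl⟩
    have hne : e a ≠ e b := fun h' => hab (e.injective h')
    exact h (Finset.mem_coe.2 ha') (Finset.mem_coe.2 hb') hne ((e.map_adj_iff).2 hadj)
  · intro h x hx y hy hxy hadj
    obtain ⟨a, ha, rfl⟩ := Finset.mem_map.1 (Finset.mem_coe.1 hx)
    obtain ⟨b, hb, rfl⟩ := Finset.mem_map.1 (Finset.mem_coe.1 hy)
    have hab : a ≠ b := fun h' => hxy (by simp [h'])
    exact h (Finset.mem_coe.2 ha) (Finset.mem_coe.2 hb) hab ((e.map_adj_iff).1 hadj)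

/-- **The hard-core sum is an isomorphism invariant** (general vertex types). -/
theorem Zs_eq_of_iso {α β : Type*} [Fintype α] [Fintype β] {G : SimpleGraph α} {H : SimpleGraph β}
    {dG : ∀ I : Finset α, Decidable (G.IsIndepSet (↑I : Set α))}
    {dH : ∀ I : Finset β, Decidable (H.IsIndepSet (↑I : Set β))} (e : G ≃g H) (lam : ℝ) :
    (∑ I : Finset α, @ite ℝ (G.IsIndepSet (↑I : Set α)) (dG I) (lam ^ I.card) 0) =
      ∑ I : Finset β, @ite ℝ (H.IsIndepSet (↑I : Set β)) (dH I) (lam ^ I.card) 0 := by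
  refine Fintype.sum_equiv (Equiv.finsetCongr e.toEquiv) _ _ fun I => ?_
  rw [Equiv.finsetCongr_apply, Finset.card_map]
  by_cases hI : G.IsIndepSet (↑I : Set α)
  · rw [if_pos hI, if_pos ((isIndepSet_map_iff' e I).2 hI)]
  · rw [if_neg hI, if_neg (fun h => hI ((isIndepSet_map_iff' e I).1 h))]

/-- Independent sets of a disjoint sum are pairs of independent sets. -/
theorem isIndepSet_disjSum_iff {α β : Type*} (G : SimpleGraph α) (H : SimpleGraph β) (s : Finset α)
    (t : Finset β) :
    (G ⊕g H).IsIndepSet (↑(s.disjSum t) : Set (α ⊕ β)) ↔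
      G.IsIndepSet (↑s : Set α) ∧ H.IsIndepSet (↑t : Set β) := by
  constructor
  · intro h
    refine ⟨fun a ha b hb hab hadj => ?_, fun a ha b hb hab hadj => ?_⟩
    · exact h (Finset.mem_coe.2 (Finset.inl_mem_disjSum.2 (Finset.mem_coe.1 ha)))
        (Finset.mem_coe.2 (Finset.inl_mem_disjSum.2 (Finset.mem_coe.1 hb)))
        (fun h' => hab (Sum.inl_injective h')) (SimpleGraph.sum_adj_inl.2 hadj)
    · exact h (Finset.mem_coe.2 (Finset.inr_mem_disjSum.2 (Finset.mem_coe.1 ha)))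
        (Finset.mem_coe.2 (Finset.inr_mem_disjSum.2 (Finset.mem_coe.1 hb)))
        (fun h' => hab (Sum.inr_injective h')) (SimpleGraph.sum_adj_inr.2 hadj)
  · rintro ⟨hs, ht⟩ x hx y hy hxy hadj
    rcases x with a | a <;> rcases y with b | b
    · exact hs (Finset.mem_coe.2 (Finset.inl_mem_disjSum.1 (Finset.mem_coe.1 hx)))
        (Finset.mem_coe.2 (Finset.inl_mem_disjSum.1 (Finset.mem_coe.1 hy)))
        (fun h' => hxy (by rw [h'])) (SimpleGraph.sum_adj_inl.1 hadj)
    · exact SimpleGraph.not_adj_sum_inl_inr a b hadj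
    · exact SimpleGraph.not_adj_sum_inl_inr b a hadj.symm
    · exact ht (Finset.mem_coe.2 (Finset.inr_mem_disjSum.1 (Finset.mem_coe.1 hx)))
        (Finset.mem_coe.2 (Finset.inr_mem_disjSum.1 (Finset.mem_coe.1 hy)))
        (fun h' => hxy (by rw [h'])) (SimpleGraph.sum_adj_inr.1 hadj)

/-- **The hard-core sum is multiplicative over disjoint sums.** -/
theorem Zs_sum {α β : Type*} [Fintype α] [Fintype β] (G : SimpleGraph α) (H : SimpleGraph β)
    {dGH : ∀ I : Finset (α ⊕ β), Decidable ((G ⊕g H).IsIndepSet (↑I : Set (α ⊕ β)))}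
    {dG : ∀ I : Finset α, Decidable (G.IsIndepSet (↑I : Set α))}
    {dH : ∀ I : Finset β, Decidable (H.IsIndepSet (↑I : Set β))} (lam : ℝ) :
    (∑ I : Finset (α ⊕ β), @ite ℝ ((G ⊕g H).IsIndepSet (↑I : Set (α ⊕ β))) (dGH I) (lam ^ I.card) 0) =
      (∑ I : Finset α, @ite ℝ (G.IsIndepSet (↑I : Set α)) (dG I) (lam ^ I.card) 0) *
        ∑ I : Finset β, @ite ℝ (H.IsIndepSet (↑I : Set β)) (dH I) (lam ^ I.card) 0 := by
  rw [← Fintype.sum_equiv Finset.sumEquiv.toEquiv.symm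
    (fun p : Finset α × Finset β => (@ite ℝ (G.IsIndepSet (↑p.1 : Set α)) (dG p.1) (lam ^ p.1.card) 0) *
      @ite ℝ (H.IsIndepSet (↑p.2 : Set β)) (dH p.2) (lam ^ p.2.card) 0) _ ?_]
  · rw [Fintype.sum_prod_type, Finset.sum_mul_sum]
  · intro p
    have happ : (Finset.sumEquiv.toEquiv.symm p : Finset (α ⊕ β)) = p.1.disjSum p.2 := rfl
    rw [happ, Finset.card_disjSum]
    have hiff := isIndepSet_disjSum_iff G H p.1 p.2
    by_cases hs : G.IsIndepSet (↑p.1 : Set α) <;> by_cases ht : H.IsIndepSet (↑p.2 : Set β)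
    · rw [if_pos hs, if_pos ht, if_pos (hiff.2 ⟨hs, ht⟩), pow_add]
    · rw [if_pos hs, if_neg ht, if_neg (fun h => ht (hiff.1 h).2), mul_zero]
    · rw [if_neg hs, if_neg (fun h => hs (hiff.1 h).1), zero_mul]
    · rw [if_neg hs, if_neg (fun h => hs (hiff.1 h).1), zero_mul]

/-- Degrees in a disjoint sum, left summand. -/
theorem degree_sum_inl {α β : Type*} [Fintype α] [Fintype β] (G : SimpleGraph α) (H : SimpleGraph β)
    [DecidableRel G.Adj] [DecidableRel (G ⊕g H).Adj] (v : α) :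
    (G ⊕g H).degree (Sum.inl v) = G.degree v := by
  rw [← SimpleGraph.card_neighborFinset_eq_degree, ← SimpleGraph.card_neighborFinset_eq_degree]
  have : (G ⊕g H).neighborFinset (Sum.inl v) = (G.neighborFinset v).map ⟨Sum.inl, Sum.inl_injective⟩ := by
    ext x
    rcases x with a | b
    · simp [SimpleGraph.mem_neighborFinset]
    · simp [SimpleGraph.mem_neighborFinset]
  rw [this, Finset.card_map]

/-- Degrees in a disjoint sum, right summand. -/
theorem degree_sum_inr {α β : Type*} [Fintype α] [Fintype β] (G : SimpleGraph α) (H : SimpleGraph β)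
    [DecidableRel H.Adj] [DecidableRel (G ⊕g H).Adj] (w : β) :
    (G ⊕g H).degree (Sum.inr w) = H.degree w := by
  rw [← SimpleGraph.card_neighborFinset_eq_degree, ← SimpleGraph.card_neighborFinset_eq_degree]
  have : (G ⊕g H).neighborFinset (Sum.inr w) = (H.neighborFinset w).map ⟨Sum.inr, Sum.inr_injective⟩ := by
    ext x
    rcases x with a | b
    · simp [SimpleGraph.mem_neighborFinset]
    · simp [SimpleGraph.mem_neighborFinset]
  rw [this, Finset.card_map]

/-- The maximum degree of a disjoint sum is bounded by the bounds of the summands. -/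
theorem maxDegree_sum_le {α β : Type*} [Fintype α] [Fintype β] {G : SimpleGraph α} {H : SimpleGraph β}
    [DecidableRel G.Adj] [DecidableRel H.Adj] [DecidableRel (G ⊕g H).Adj] {Δ : ℕ}
    (hG : G.maxDegree ≤ Δ) (hH : H.maxDegree ≤ Δ) : (G ⊕g H).maxDegree ≤ Δ := by
  refine SimpleGraph.maxDegree_le_of_forall_degree_le _ _ fun x => ?_
  rcases x with v | w
  · have h1 : (G ⊕g H).degree (Sum.inl v) = G.degree v := degree_sum_inl G H v
    calc _ = G.degree v := by convert h1
      _ ≤ Δ := (G.degree_le_maxDegree v).trans hG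
  · have h1 : (G ⊕g H).degree (Sum.inr w) = H.degree w := degree_sum_inr G H w
    calc _ = H.degree w := by convert h1
      _ ≤ Δ := (H.degree_le_maxDegree w).trans hH

/-! THE DOUBLE of a graph `G` on `Fin n` is `(G ⊕g G).map finSumFinEquiv` on `Fin (n + n)` (two disjoint copies),
reached through the isomorphism `SimpleGraph.Iso.map finSumFinEquiv (G ⊕g G)`; the lemmas are stated for any `D`
isomorphic to `G ⊕g G`. -/

/-- `Z(D) = Z(G)²` for any graph `D` isomorphic to two disjoint copies of `G` (stated through an isomorphism so
that the decidability instances of the inlined sums stay generic). -/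
theorem Zs_double {n k : ℕ} {G : SimpleGraph (Fin n)} {D : SimpleGraph (Fin k)}
    {dD : ∀ I : Finset (Fin k), Decidable (D.IsIndepSet (↑I : Set (Fin k)))}
    {dG : ∀ I : Finset (Fin n), Decidable (G.IsIndepSet (↑I : Set (Fin n)))} (e : (G ⊕g G) ≃g D)
    (lam : ℝ) :
    (∑ I : Finset (Fin k), @ite ℝ (D.IsIndepSet (↑I : Set (Fin k))) (dD I) (lam ^ I.card) 0) =
      (∑ I : Finset (Fin n), @ite ℝ (G.IsIndepSet (↑I : Set (Fin n))) (dG I) (lam ^ I.card) 0) ^ 2 := by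
  calc (∑ I : Finset (Fin k), @ite ℝ (D.IsIndepSet (↑I : Set (Fin k))) (dD I) (lam ^ I.card) 0)
        = ∑ I : Finset (Fin n ⊕ Fin n),
            @ite ℝ ((G ⊕g G).IsIndepSet (↑I : Set (Fin n ⊕ Fin n))) (Classical.dec _) (lam ^ I.card) 0 :=
          (Zs_eq_of_iso (dG := fun I => Classical.dec _) (dH := dD) e lam).symm
    _ = (∑ I : Finset (Fin n), @ite ℝ (G.IsIndepSet (↑I : Set (Fin n))) (dG I) (lam ^ I.card) 0) *
          ∑ I : Finset (Fin n), @ite ℝ (G.IsIndepSet (↑I : Set (Fin n))) (dG I) (lam ^ I.card) 0 :=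
          Zs_sum G G (dGH := fun I => Classical.dec _) (dG := dG) (dH := dG) lam
    _ = _ := (sq _).symm

/-- Two disjoint copies have the same degree bound. -/
theorem maxDegree_double_le {n k : ℕ} {G : SimpleGraph (Fin n)} {D : SimpleGraph (Fin k)}
    (e : (G ⊕g G) ≃g D) {Δ : ℕ} (hG : G.maxDegree ≤ Δ) : D.maxDegree ≤ Δ := by
  have h1 : (G ⊕g G).maxDegree ≤ Δ := maxDegree_sum_le hG hG
  rw [← e.maxDegree_eq]
  convert h1

/-- **Hom-indistinguishability of the doubles, one level down in the exponent.** If `G, H` on `n ≥ 2` vertices are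
hom-indistinguishable below depth `n^θ` (`θ > 0`), their doubles are hom-indistinguishable below depth
`(2n)^{θ/2} ≤ n^θ` (Dvořák bridge both ways, `CkEquiv.sum`, `CkEquiv.iso_congr` — all PROVED in the tree). -/
theorem homIndist_double {n : ℕ} (hn : 2 ≤ n) {θ : ℝ} (hθ : 0 < θ) {G H : SimpleGraph (Fin n)}
    {D E : SimpleGraph (Fin (n + n))} (eG : (G ⊕g G) ≃g D) (eH : (H ⊕g H) ≃g E)
    (h : ∀ (m : ℕ) (F : SimpleGraph (Fin m)),
      (Literature.Combinatorics.SimpleGraph.treewidth F : ℝ) < (n : ℝ) ^ θ →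
        Nat.card (F →g G) = Nat.card (F →g H)) :
    ∀ (m : ℕ) (F : SimpleGraph (Fin m)),
      (Literature.Combinatorics.SimpleGraph.treewidth F : ℝ) < ((n + n : ℕ) : ℝ) ^ (θ / 2) →
        Nat.card (F →g D) = Nat.card (F →g E) := by
  -- the real threshold `x = (2n)^{θ/2}` and the integer level `k = ⌈x⌉`
  set x : ℝ := ((n + n : ℕ) : ℝ) ^ (θ / 2) with hx
  have hn2 : (2 : ℝ) ≤ n := by exact_mod_cast hn
  have hnn : ((n + n : ℕ) : ℝ) = 2 * n := by push_cast; ring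
  have hx1 : 1 < x := by
    rw [hx, hnn]
    have h4 : (1 : ℝ) < 2 * n := by linarith
    exact Real.one_lt_rpow h4 (by linarith)
  have hx0 : 0 ≤ x := by linarith
  -- `(2n)^{θ/2} ≤ n^θ` since `2n ≤ n²`
  have hxle : x ≤ (n : ℝ) ^ θ := by
    rw [hx, hnn]
    have hsq : (2 : ℝ) * n ≤ (n : ℝ) ^ (2 : ℝ) := by
      rw [Real.rpow_two]; nlinarith
    calc (2 * (n : ℝ)) ^ (θ / 2) ≤ ((n : ℝ) ^ (2 : ℝ)) ^ (θ / 2) :=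
          Real.rpow_le_rpow (by linarith) hsq (by linarith)
      _ = (n : ℝ) ^ θ := by
          rw [← Real.rpow_mul (by linarith)]
          congr 1; ring
  set k : ℕ := ⌈x⌉₊ with hk
  have hk2 : 2 ≤ k := by
    rw [hk]
    have : (1 : ℝ) < ⌈x⌉₊ := lt_of_lt_of_le hx1 (Nat.le_ceil x)
    have h' : 1 < ⌈x⌉₊ := by exact_mod_cast this
    omega
  have hkx : ((k : ℝ) - 1) < x := by
    rw [hk]
    have := Nat.ceil_lt_add_one hx0
    linarith
  -- level-`k` equivalence of `G` and `H`
  have hGH : CkEquiv k G H := by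
    refine (Dvorak2010_ckEquiv_iff_homCount_holds k hk2 n n G H).2 fun j F hF => h j F ?_
    have hF' : (Literature.Combinatorics.SimpleGraph.treewidth F : ℝ) ≤ (k : ℝ) - 1 := by
      have : Literature.Combinatorics.SimpleGraph.treewidth F + 1 ≤ k := hF
      have : ((Literature.Combinatorics.SimpleGraph.treewidth F + 1 : ℕ) : ℝ) ≤ k := by exact_mod_cast this
      push_cast at this
      linarith
    exact lt_of_le_of_lt hF' (lt_of_lt_of_le hkx hxle)
  -- the doubles are `≡_{C^k}`
  have hD : CkEquiv k D E := (CkEquiv.sum hGH hGH).iso_congr eG eH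
  intro m F hF
  refine (Dvorak2010_ckEquiv_iff_homCount_holds k hk2 (n + n) (n + n) D E).1 hD m F ?_
  -- `tw F < x ≤ ⌈x⌉ = k`
  have : (Literature.Combinatorics.SimpleGraph.treewidth F : ℝ) < k :=
    lt_of_lt_of_le hF (by rw [hk]; exact Nat.le_ceil x)
  exact_mod_cast this

/-- **Factor squaring.** A witness family for the crux body at `(Δ, λ ≥ 0)` with exponent `θ > 0` and gap factor
`c ≥ 0` yields one with exponent `θ/2` and gap factor `c²`. -/
theorem witnesses_sq {Δ : ℕ} {lam θ c : ℝ} (hlam : 0 ≤ lam) (hθ : 0 < θ) (hc : 0 ≤ c)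
    (h : ∀ n₀ : ℕ, ∃ (n : ℕ) (G H : SimpleGraph (Fin n)), n₀ ≤ n ∧ G.maxDegree ≤ Δ ∧ H.maxDegree ≤ Δ ∧
      (∀ (m : ℕ) (F : SimpleGraph (Fin m)),
        (Literature.Combinatorics.SimpleGraph.treewidth F : ℝ) < (n : ℝ) ^ θ →
          Nat.card (F →g G) = Nat.card (F →g H)) ∧
      c * (∑ I : Finset (Fin n), (if H.IsIndepSet (↑I : Set (Fin n)) then lam ^ I.card else 0)) ≤
        ∑ I : Finset (Fin n), (if G.IsIndepSet (↑I : Set (Fin n)) then lam ^ I.card else 0)) :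
    ∀ n₀ : ℕ, ∃ (n : ℕ) (G H : SimpleGraph (Fin n)), n₀ ≤ n ∧ G.maxDegree ≤ Δ ∧ H.maxDegree ≤ Δ ∧
      (∀ (m : ℕ) (F : SimpleGraph (Fin m)),
        (Literature.Combinatorics.SimpleGraph.treewidth F : ℝ) < (n : ℝ) ^ (θ / 2) →
          Nat.card (F →g G) = Nat.card (F →g H)) ∧
      c ^ 2 * (∑ I : Finset (Fin n), (if H.IsIndepSet (↑I : Set (Fin n)) then lam ^ I.card else 0)) ≤
        ∑ I : Finset (Fin n), (if G.IsIndepSet (↑I : Set (Fin n)) then lam ^ I.card else 0) := by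
  intro n₀
  obtain ⟨n, G, H, hn, hG, hH, hhom, hZ⟩ := h (max n₀ 2)
  have hn0 : n₀ ≤ n := le_trans (le_max_left _ _) hn
  have hn2 : 2 ≤ n := le_trans (le_max_right _ _) hn
  -- the claim for ANY pair of graphs isomorphic to the two doubles (generic statement: the decidability
  -- instances of the inlined sums are then the generic ones on both sides)
  have key : ∀ (D E : SimpleGraph (Fin (n + n))), (G ⊕g G ≃g D) → (H ⊕g H ≃g E) →
      D.maxDegree ≤ Δ ∧ E.maxDegree ≤ Δ ∧
      (∀ (m : ℕ) (F : SimpleGraph (Fin m)),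
        (Literature.Combinatorics.SimpleGraph.treewidth F : ℝ) < ((n + n : ℕ) : ℝ) ^ (θ / 2) →
          Nat.card (F →g D) = Nat.card (F →g E)) ∧
      c ^ 2 * (∑ I : Finset (Fin (n + n)), (if E.IsIndepSet (↑I : Set (Fin (n + n))) then lam ^ I.card else 0)) ≤
        ∑ I : Finset (Fin (n + n)), (if D.IsIndepSet (↑I : Set (Fin (n + n))) then lam ^ I.card else 0) := by
    intro D E eG eH
    refine ⟨maxDegree_double_le eG hG, maxDegree_double_le eH hH, homIndist_double hn2 hθ eG eH hhom, ?_⟩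
    have hD : (∑ I : Finset (Fin (n + n)), (if D.IsIndepSet (↑I : Set (Fin (n + n))) then lam ^ I.card else 0)) =
        (∑ I : Finset (Fin n), (if G.IsIndepSet (↑I : Set (Fin n)) then lam ^ I.card else 0)) ^ 2 :=
      Zs_double (dD := fun I => inferInstance) (dG := fun I => inferInstance) eG lam
    have hE : (∑ I : Finset (Fin (n + n)), (if E.IsIndepSet (↑I : Set (Fin (n + n))) then lam ^ I.card else 0)) =
        (∑ I : Finset (Fin n), (if H.IsIndepSet (↑I : Set (Fin n)) then lam ^ I.card else 0)) ^ 2 :=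
      Zs_double (dD := fun I => inferInstance) (dG := fun I => inferInstance) eH lam
    rw [hD, hE]
    have hZH := Zs_nonneg H (dG := fun I => inferInstance) hlam
    calc c ^ 2 * (∑ I : Finset (Fin n), (if H.IsIndepSet (↑I : Set (Fin n)) then lam ^ I.card else 0)) ^ 2 =
        (c * (∑ I : Finset (Fin n), (if H.IsIndepSet (↑I : Set (Fin n)) then lam ^ I.card else 0))) ^ 2 := by
          ring
      _ ≤ (∑ I : Finset (Fin n), (if G.IsIndepSet (↑I : Set (Fin n)) then lam ^ I.card else 0)) ^ 2 :=
          pow_le_pow_left₀ (mul_nonneg hc hZH) hZ 2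
  obtain ⟨h1, h2, h3, h4⟩ :=
    key _ _ (SimpleGraph.Iso.map finSumFinEquiv (G ⊕g G)) (SimpleGraph.Iso.map finSumFinEquiv (H ⊕g H))
  exact ⟨n + n, _, _, by omega, h1, h2, h3, h4⟩

/-- **Iterated squaring:** factor `c` at exponent `θ` gives factor `c^(2^j)` at exponent `θ/2^j`. -/
theorem witnesses_pow {Δ : ℕ} {lam θ c : ℝ} (hlam : 0 ≤ lam) (hθ : 0 < θ) (hc : 0 ≤ c)
    (h : ∀ n₀ : ℕ, ∃ (n : ℕ) (G H : SimpleGraph (Fin n)), n₀ ≤ n ∧ G.maxDegree ≤ Δ ∧ H.maxDegree ≤ Δ ∧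
      (∀ (m : ℕ) (F : SimpleGraph (Fin m)),
        (Literature.Combinatorics.SimpleGraph.treewidth F : ℝ) < (n : ℝ) ^ θ →
          Nat.card (F →g G) = Nat.card (F →g H)) ∧
      c * (∑ I : Finset (Fin n), (if H.IsIndepSet (↑I : Set (Fin n)) then lam ^ I.card else 0)) ≤
        ∑ I : Finset (Fin n), (if G.IsIndepSet (↑I : Set (Fin n)) then lam ^ I.card else 0)) (j : ℕ) :
    ∀ n₀ : ℕ, ∃ (n : ℕ) (G H : SimpleGraph (Fin n)), n₀ ≤ n ∧ G.maxDegree ≤ Δ ∧ H.maxDegree ≤ Δ ∧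
      (∀ (m : ℕ) (F : SimpleGraph (Fin m)),
        (Literature.Combinatorics.SimpleGraph.treewidth F : ℝ) < (n : ℝ) ^ (θ / 2 ^ j) →
          Nat.card (F →g G) = Nat.card (F →g H)) ∧
      c ^ (2 ^ j) * (∑ I : Finset (Fin n), (if H.IsIndepSet (↑I : Set (Fin n)) then lam ^ I.card else 0)) ≤
        ∑ I : Finset (Fin n), (if G.IsIndepSet (↑I : Set (Fin n)) then lam ^ I.card else 0) := by
  induction j with
  | zero => simpa using h
  | succ j ih =>
    have hθj : 0 < θ / 2 ^ j := div_pos hθ (pow_pos two_pos _)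
    have := witnesses_sq hlam hθj (pow_nonneg hc _) ih
    have hexp : θ / 2 ^ j / 2 = θ / 2 ^ (j + 1) := by rw [pow_succ]; ring
    have hpow : (c ^ 2 ^ j) ^ 2 = c ^ 2 ^ (j + 1) := by rw [← pow_mul, ← pow_succ]
    simpa [hexp, hpow] using this

/-- **A would-be disproof must exclude `(1+ε)`-twins for every `ε > 0`.** If at `(Δ, λ ≥ 0)` there are NO factor-`2`
twins at any positive exponent (the negation of the crux's conclusion there, `Zs`-form), then for every `ε > 0` there
are no factor-`(1+ε)` twins at any positive exponent either. -/
theorem noTwins_onePlusEps_of_noTwins {Δ : ℕ} {lam : ℝ} (hlam : 0 ≤ lam)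
    (hno : ¬ ∃ θ : ℝ, 0 < θ ∧ ∀ n₀ : ℕ, ∃ (n : ℕ) (G H : SimpleGraph (Fin n)), n₀ ≤ n ∧
      G.maxDegree ≤ Δ ∧ H.maxDegree ≤ Δ ∧
      (∀ (m : ℕ) (F : SimpleGraph (Fin m)),
        (Literature.Combinatorics.SimpleGraph.treewidth F : ℝ) < (n : ℝ) ^ θ →
          Nat.card (F →g G) = Nat.card (F →g H)) ∧
      2 * (∑ I : Finset (Fin n), (if H.IsIndepSet (↑I : Set (Fin n)) then lam ^ I.card else 0)) ≤
        ∑ I : Finset (Fin n), (if G.IsIndepSet (↑I : Set (Fin n)) then lam ^ I.card else 0))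
    {ε : ℝ} (hε : 0 < ε) :
    ¬ ∃ θ : ℝ, 0 < θ ∧ ∀ n₀ : ℕ, ∃ (n : ℕ) (G H : SimpleGraph (Fin n)), n₀ ≤ n ∧
      G.maxDegree ≤ Δ ∧ H.maxDegree ≤ Δ ∧
      (∀ (m : ℕ) (F : SimpleGraph (Fin m)),
        (Literature.Combinatorics.SimpleGraph.treewidth F : ℝ) < (n : ℝ) ^ θ →
          Nat.card (F →g G) = Nat.card (F →g H)) ∧
      (1 + ε) * (∑ I : Finset (Fin n), (if H.IsIndepSet (↑I : Set (Fin n)) then lam ^ I.card else 0)) ≤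
        ∑ I : Finset (Fin n), (if G.IsIndepSet (↑I : Set (Fin n)) then lam ^ I.card else 0) := by
  rintro ⟨θ, hθ, h⟩
  apply hno
  -- choose `j` with `(1+ε)^(2^j) ≥ 2`
  obtain ⟨j, hj⟩ : ∃ j : ℕ, (2 : ℝ) ≤ (1 + ε) ^ (2 ^ j) := by
    obtain ⟨N, hN⟩ := pow_unbounded_of_one_lt (2 : ℝ) (by linarith : (1 : ℝ) < 1 + ε)
    refine ⟨N, le_trans hN.le ?_⟩
    exact pow_le_pow_right₀ (by linarith) (Nat.lt_two_pow_self).le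
  refine ⟨θ / 2 ^ j, div_pos hθ (pow_pos two_pos _), fun n₀ => ?_⟩
  obtain ⟨n, G, H, hn, hG, hH, hhom, hZ⟩ := witnesses_pow hlam hθ (by linarith) h j n₀
  refine ⟨n, G, H, hn, hG, hH, hhom, le_trans ?_ hZ⟩
  exact mul_le_mul_of_nonneg_right hj (Zs_nonneg H hlam)

/-- **The gap factor is immaterial (negative forms equivalent for every `c > 1`).** At `(Δ, λ ≥ 0)`: there are no
factor-`c` twins at any positive exponent iff there are no factor-`2` twins at any positive exponent.  (`c ≤ 2`:
amplify `c = (1 + (c-1))` by `noTwins_onePlusEps_of_noTwins`; `c > 2`: amplify `2` by `witnesses_pow`.) -/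
theorem noTwins_iff_noTwins_two {Δ : ℕ} {lam : ℝ} (hlam : 0 ≤ lam) {c : ℝ} (hc : 1 < c) :
    (¬ ∃ θ : ℝ, 0 < θ ∧ ∀ n₀ : ℕ, ∃ (n : ℕ) (G H : SimpleGraph (Fin n)), n₀ ≤ n ∧
      G.maxDegree ≤ Δ ∧ H.maxDegree ≤ Δ ∧
      (∀ (m : ℕ) (F : SimpleGraph (Fin m)),
        (Literature.Combinatorics.SimpleGraph.treewidth F : ℝ) < (n : ℝ) ^ θ →
          Nat.card (F →g G) = Nat.card (F →g H)) ∧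
      c * (∑ I : Finset (Fin n), (if H.IsIndepSet (↑I : Set (Fin n)) then lam ^ I.card else 0)) ≤
        ∑ I : Finset (Fin n), (if G.IsIndepSet (↑I : Set (Fin n)) then lam ^ I.card else 0)) ↔
    (¬ ∃ θ : ℝ, 0 < θ ∧ ∀ n₀ : ℕ, ∃ (n : ℕ) (G H : SimpleGraph (Fin n)), n₀ ≤ n ∧
      G.maxDegree ≤ Δ ∧ H.maxDegree ≤ Δ ∧
      (∀ (m : ℕ) (F : SimpleGraph (Fin m)),
        (Literature.Combinatorics.SimpleGraph.treewidth F : ℝ) < (n : ℝ) ^ θ →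
          Nat.card (F →g G) = Nat.card (F →g H)) ∧
      2 * (∑ I : Finset (Fin n), (if H.IsIndepSet (↑I : Set (Fin n)) then lam ^ I.card else 0)) ≤
        ∑ I : Finset (Fin n), (if G.IsIndepSet (↑I : Set (Fin n)) then lam ^ I.card else 0)) := by
  constructor
  · -- no `c`-twins ⇒ no `2`-twins: amplify a `2`-family to factor `2^(2^j) ≥ c`
    intro hno
    rintro ⟨θ, hθ, h⟩
    apply hno
    obtain ⟨j, hj⟩ : ∃ j : ℕ, c ≤ (2 : ℝ) ^ (2 ^ j) := by
      obtain ⟨N, hN⟩ := pow_unbounded_of_one_lt c (by norm_num : (1 : ℝ) < 2)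
      exact ⟨N, le_trans hN.le (pow_le_pow_right₀ (by norm_num) (Nat.lt_two_pow_self).le)⟩
    refine ⟨θ / 2 ^ j, div_pos hθ (pow_pos two_pos _), fun n₀ => ?_⟩
    obtain ⟨n, G, H, hn, hG, hH, hhom, hZ⟩ := witnesses_pow hlam hθ (by norm_num : (0:ℝ) ≤ 2) h j n₀
    exact ⟨n, G, H, hn, hG, hH, hhom, le_trans (mul_le_mul_of_nonneg_right hj (Zs_nonneg H hlam)) hZ⟩
  · -- no `2`-twins ⇒ no `c`-twins: `c = 1 + (c - 1)`
    intro hno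
    have := noTwins_onePlusEps_of_noTwins hlam hno (ε := c - 1) (by linarith)
    simpa [add_sub_cancel] using this

end Summit.PneNP.PneNP.Theorems.PolyDepthTwinsAbove.Negative
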